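import Mathlib

set_option linter.dupNamespace false

/-!
# Pairing disjoint closed walks into support-disjoint gadgets (`stub_pairUp`)

Stub R4 of the line `spherical-rank-sieve` for the crux `HyperoctahedralSubsets`.

Given three involutions `μ 0, μ 1, μ 2` of `Fin n`, a cyclically non-backtracking colour word
`col : Fin (k+2) → Fin 3` and a finset `S` of injective, pairwise point-disjoint closed walks of `col`
with `2G ≤ |S|`, we build `G` support-disjoint gadgets (commuting local triples), by enumerating
`2G` walks of `S` injectively and applying the clean-cycle gadget theorem (taken as the last
hypothesis, verbatim) to the pairs `(p_(2j), p_(2j+1))`.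
-/

namespace Summit.MatrixMultiplication.MatrixMultiplication.Theorems.HyperoctahedralSubsets

namespace PairUp

/-- From `m ≤ S.card` extract an injective `m`-tuple of elements of `S`. -/
theorem exists_injective_of_le_card {α : Type*} (S : Finset α) {m : ℕ} (h : m ≤ S.card) :
    ∃ f : Fin m → α, Function.Injective f ∧ ∀ i, f i ∈ S :=
  ⟨fun i => (S.equivFin.symm (Fin.castLE h i)).1,
    fun _ _ hij => Fin.castLE_injective h (S.equivFin.symm.injective (Subtype.val_injective hij)),
    fun i => (S.equivFin.symm (Fin.castLE h i)).2⟩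

/-- Index arithmetic: the even index `2j` is below `2G` for `j < G`. -/
theorem two_mul_lt {G : ℕ} (j : Fin G) : 2 * (j : ℕ) < 2 * G := by
  have := j.isLt
  omega

/-- Index arithmetic: the odd index `2j+1` is below `2G` for `j < G`. -/
theorem two_mul_succ_lt {G : ℕ} (j : Fin G) : 2 * (j : ℕ) + 1 < 2 * G := by
  have := j.isLt
  omega

/-- The even and odd indices `2j` and `2j+1` are distinct elements of `Fin (2G)`. -/
theorem even_ne_odd {G : ℕ} (j : Fin G) :
    (⟨2 * (j : ℕ), two_mul_lt j⟩ : Fin (2 * G)) ≠ ⟨2 * (j : ℕ) + 1, two_mul_succ_lt j⟩ := by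
  intro h
  have := Fin.mk.inj h
  omega

end PairUp

/-- **Stub R4 · `stub_pairUp`.**  `2G` injective, pairwise point-disjoint closed walks of one cyclically
non-backtracking word of length `k+2` give `G` support-disjoint gadgets: enumerate `2G` of them
injectively and apply the clean-cycle gadget theorem (the last hypothesis, verbatim) to the pair
`(p_(2j), p_(2j+1))`; the supports lie on the two trajectories, hence are pairwise disjoint, which
gives the pairwise-fixing clause, and are covered by walks of `S`. -/
theorem stub_pairUp : ∀ (n k G : ℕ) (μ : Fin 3 → Equiv.Perm (Fin n)) (col : Fin (k + 2) → Fin 3) (S : Finset (Fin (k + 2) → Fin n)), (∀ c, μ c * μ c = 1) → (∀ i, col i ≠ col (i + 1)) → (∀ p ∈ S, (∀ i, μ (col i) (p i) = p (i + 1)) ∧ Function.Injective p) → (∀ p ∈ S, ∀ q ∈ S, p ≠ q → ∀ i j, p i ≠ q j) → 2 * G ≤ S.card → (∀ (n k : ℕ) (μ : Fin 3 → Equiv.Perm (Fin n)) (p q : Fin (k + 2) → Fin n) (col : Fin (k + 2) → Fin 3), (∀ c, μ c * μ c = 1) → Function.Injective p → Function.Injective q → (∀ i j, p i ≠ q j)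 → (∀ i, μ (col i) (p i) = p (i + 1) ∧ μ (col i) (q i) = q (i + 1)) → (∀ i, col i ≠ col (i + 1)) → ∃ a b : Equiv.Perm (Fin n), a * a = 1 ∧ b * b = 1 ∧ a * b = b * a ∧ (a ≠ 1 ∨ b ≠ 1) ∧ a * μ 0 = μ 0 * a ∧ b * μ 1 = μ 1 * b ∧ a * b * μ 2 = μ 2 * (a * b) ∧ (∀ v, (a v ≠ v ∨ b v ≠ v) → ∃ i, v = p i ∨ v = q i)) → ∃ (a b : Fin G → Equiv.Perm (Fin n)), (∀ j, a j * a j = 1 ∧ b j * b j = 1 ∧ a j * b j = b j * a j ∧ (a j ≠ 1 ∨ b j ≠ 1) ∧ a j * μ 0 = μ 0 * a j ∧ b j * μ 1 = μ 1 * b j ∧ a j * b j * μ 2 = μ 2 * (a j * b j)) ∧ (∀ j j' : Fin G, j ≠ j' → ∀ v, (a j v ≠ v ∨ b j v ≠ v) → a j' v = v ∧ b j' v = v) ∧ (∀ j v, (a j v ≠ v ∨ b j v ≠ v) → ∃ p ∈ S, ∃ i, p i = v) := by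
  intro n k G μ col S hμ hcol hS hdisj hG hC
  obtain ⟨f, hf_inj, hf_mem⟩ := PairUp.exists_injective_of_le_card S hG
  -- distinct enumerated walks are point-disjoint
  have hfd : ∀ i i' : Fin (2 * G), i ≠ i' → ∀ x y, f i x ≠ f i' y := fun i i' hii' =>
    hdisj (f i) (hf_mem i) (f i') (hf_mem i') fun h => hii' (hf_inj h)
  -- one gadget per pair `(f (2j), f (2j+1))`
  have hex : ∀ j : Fin G, ∃ a b : Equiv.Perm (Fin n), a * a = 1 ∧ b * b = 1 ∧ a * b = b * a ∧
      (a ≠ 1 ∨ b ≠ 1) ∧ a * μ 0 = μ 0 * a ∧ b * μ 1 = μ 1 * b ∧ a * b * μ 2 = μ 2 * (a * b) ∧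
      (∀ v, (a v ≠ v ∨ b v ≠ v) → ∃ i, v = f ⟨2 * (j : ℕ), PairUp.two_mul_lt j⟩ i ∨
        v = f ⟨2 * (j : ℕ) + 1, PairUp.two_mul_succ_lt j⟩ i) := by
    intro j
    have hPm := hf_mem ⟨2 * (j : ℕ), PairUp.two_mul_lt j⟩
    have hQm := hf_mem ⟨2 * (j : ℕ) + 1, PairUp.two_mul_succ_lt j⟩
    exact hC n k μ _ _ col hμ (hS _ hPm).2 (hS _ hQm).2 (hfd _ _ (PairUp.even_ne_odd j))
      (fun i => ⟨(hS _ hPm).1 i, (hS _ hQm).1 i⟩) hcol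
  choose a b hab using hex
  refine ⟨a, b, fun j => ?_, ?_, ?_⟩
  · obtain ⟨h1, h2, h3, h4, h5, h6, h7, -⟩ := hab j
    exact ⟨h1, h2, h3, h4, h5, h6, h7⟩
  · -- pairwise fixing: the four walks `f (2j), f (2j+1), f (2j'), f (2j'+1)` are pairwise point-disjoint
    intro j j' hjj' v hv
    obtain ⟨i, hi⟩ := (hab j).2.2.2.2.2.2.2 v hv
    by_contra hcon
    obtain ⟨i', hi'⟩ := (hab j').2.2.2.2.2.2.2 v (not_and_or.mp hcon)
    have hne : (j : ℕ) ≠ (j' : ℕ) := fun h => hjj' (Fin.ext h)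
    rcases hi with hi | hi <;> rcases hi' with hi' | hi' <;>
      exact hfd _ _ (by intro h; have := Fin.mk.inj h; omega) _ _ (hi.symm.trans hi')
  · -- supports are covered by walks of `S`
    intro j v hv
    obtain ⟨i, hi⟩ := (hab j).2.2.2.2.2.2.2 v hv
    rcases hi with hi | hi
    · exact ⟨_, hf_mem _, i, hi.symm⟩
    · exact ⟨_, hf_mem _, i, hi.symm⟩

end Summit.MatrixMultiplication.MatrixMultiplication.Theorems.HyperoctahedralSubsets
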